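import Mathlib
import Summits.KontsevichZagierPeriods.KontsevichZagierPeriods.Theses.HurwitzMicroSectors

/-!
# Sketch — crux ReductionTwoSix (stmt-KontsevichZagierPeriods-3871), crux-ideate round 1, ideator 2

First lemmas of three idea cards (they need not be proved; they must elaborate), plus the
kernel-checked pointwise identities behind them.

* card `jacobian-monomials`      : `MonomialIsJacobian`
* card `cyclotomic-logderivative-descent` : `OddPairKill`, `LogDerivativeKillThree`, and the four
  pointwise identities `dil2_e1`, `dil2_e3`, `dil3_e1`, `dil2_f3` (proved)
* card `numerator-module-transfer` : `NumeratorModule` (pure algebra, the transfer C⁺) and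
  `DilationGeneratorTwo` / `DilationGeneratorThree` (the interface: each generator family is one move)
-/

namespace Summit.KontsevichZagierPeriods.KontsevichZagierPeriods.Cruxes.ReductionTwoSix.Ideator2

open Literature.NumberTheory.Transcendental Set MeasureTheory Polynomial
open Summit.KontsevichZagierPeriods.KontsevichZagierPeriods.Theses.HurwitzMicroSectors

noncomputable section

/-- The open unit box `(0,1)²`, written exactly as in the route file. -/
def box : Set (Fin 2 → ℝ) := {x | ∀ i, x i ∈ Set.Ioo (0:ℝ) 1}

/-! ## Card `jacobian-monomials` -/

/-- FIRST LEMMA (card jacobian-monomials): a monomial is the Jacobian of a dilation —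
`D_{k+1}(q) = (k+1)² t^k · q` — so `⟨q (xy)^k⟩ ∼ ⟨q/(k+1)²⟩` on the SAME open box by ONE
change-of-variables move (`DilationMove` with `m = k+1` applied to the constant rep), no rule 3). -/
def MonomialIsJacobian : Prop :=
  DilationMove → ∀ (k : ℕ) (q : ℚ) (r r' : KZ.IntegralRep 2), r.domain = box → r'.domain = box →
    EqOn r.integrand (fun x => (q : ℝ) * (x 0 * x 1) ^ k) box →
    EqOn r'.integrand (fun _ => (q : ℝ) / ((k : ℝ) + 1) ^ 2) box →
    KZ.Equivalent r r'

/-- The pointwise identity behind `MonomialIsJacobian`: the `DilationMove` hypothesis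
`r.integrand x = r'.integrand (x_i^m) * (m^2 * ∏ x_i^(m-1))` with `m = k+1`, `n = 2`. -/
theorem monomial_pointwise (k : ℕ) (q : ℝ) (x : Fin 2 → ℝ) :
    q * (x 0 * x 1) ^ k
      = q / ((k:ℝ) + 1) ^ 2 * (((k + 1 : ℕ) : ℝ) ^ 2 * ∏ i : Fin 2, x i ^ (k + 1 - 1)) := by
  have hk : ((k:ℝ) + 1) ≠ 0 := by positivity
  simp only [Nat.add_sub_cancel, Fin.prod_univ_two, Nat.cast_add, Nat.cast_one]
  field_simp
  ring

/-! ## Card `cyclotomic-logderivative-descent` -/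

/-- (i) `D₂[1/(1−t)] = 4t/(1−t²) = 2/(1−t) − 2/(1+t)`: kills `1/Φ₂`. -/
theorem dil2_e1 (t : ℝ) (ht : t ∈ Ioo (0:ℝ) 1) :
    4 * t / (1 - (t ^ 2)) = 2 / (1 - t) - 2 / (1 + t) := by
  have h1 : (1:ℝ) - t ≠ 0 := by linarith [ht.2, sub_pos.mpr ht.2]
  have h2 : (1:ℝ) + t ≠ 0 := by linarith [ht.1]
  have h3 : (1:ℝ) - t ^ 2 = (1 - t) * (1 + t) := by ring
  rw [h3]
  field_simp
  ring

/-- (ii) `D₂[1/Φ₃] = 4t/(1+t²+t⁴) = 2/Φ₆ − 2/Φ₃` (since `Φ₃(t²) = Φ₃Φ₆` and `Φ₃ − Φ₆ = 2t`):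
identifies the odd level-6 piece `1/Φ₆` with `(3/2)·1/Φ₃`. -/
theorem dil2_e3 (t : ℝ) :
    4 * t / (1 + t ^ 2 + (t ^ 2) ^ 2) = 2 / (1 - t + t ^ 2) - 2 / (1 + t + t ^ 2) := by
  have h3 : (1:ℝ) + t + t ^ 2 ≠ 0 := by nlinarith [sq_nonneg (t + 1/2)]
  have h6 : (1:ℝ) - t + t ^ 2 ≠ 0 := by nlinarith [sq_nonneg (t - 1/2)]
  have hf : (1:ℝ) + t ^ 2 + (t ^ 2) ^ 2 = (1 + t + t ^ 2) * (1 - t + t ^ 2) := by ring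
  rw [hf]
  field_simp
  ring

/-- (iii) `D₃[1/(1−t)] = 9t²/(1−t³) = 3/(1−t) − 3(1+2t)/Φ₃`: kills the log-derivative `Φ₃'/Φ₃`. -/
theorem dil3_e1 (t : ℝ) (ht : t ∈ Ioo (0:ℝ) 1) :
    9 * t ^ 2 / (1 - t ^ 3) = 3 / (1 - t) - 3 * (1 + 2 * t) / (1 + t + t ^ 2) := by
  have h1 : (1:ℝ) - t ≠ 0 := by linarith [ht.2, sub_pos.mpr ht.2]
  have h3 : (1:ℝ) + t + t ^ 2 ≠ 0 := by nlinarith [sq_nonneg (t + 1/2)]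
  have hf : (1:ℝ) - t ^ 3 = (1 - t) * (1 + t + t ^ 2) := by ring
  rw [hf]
  field_simp
  ring

/-- (iv) `D₂[Φ₃'/Φ₃] = 4t(1+2t²)/(1+t²+t⁴) = 2Φ₃'/Φ₃ + 2Φ₆'/Φ₆`
(`d log Φ₃(t²) = d log Φ₃ + d log Φ₆`): kills the log-derivative `Φ₆'/Φ₆`. -/
theorem dil2_f3 (t : ℝ) :
    4 * t * ((1 + 2 * t ^ 2) / (1 + t ^ 2 + (t ^ 2) ^ 2))
      = 2 * (1 + 2 * t) / (1 + t + t ^ 2) + 2 * (2 * t - 1) / (1 - t + t ^ 2) := by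
  have h3 : (1:ℝ) + t + t ^ 2 ≠ 0 := by nlinarith [sq_nonneg (t + 1/2)]
  have h6 : (1:ℝ) - t + t ^ 2 ≠ 0 := by nlinarith [sq_nonneg (t - 1/2)]
  have hf : (1:ℝ) + t ^ 2 + (t ^ 2) ^ 2 = (1 + t + t ^ 2) * (1 - t + t ^ 2) := by ring
  rw [hf]
  field_simp
  ring

/-- FIRST LEMMA (card cyclotomic-logderivative-descent): the ODD-PAIR KILL at the move level —
`⟨q/Φ₆⟩ ∼ ⟨(3q/2)/Φ₃⟩` on the open box, for every rational `q` (one `DilationMove` instance with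
`m = 2` on the rep with integrand `(q/2)/Φ₃(xy)`, identity `dil2_e3`, two integrand-additivity
moves). -/
def OddPairKill : Prop :=
  DilationMove → ∀ (q : ℚ) (r r' : KZ.IntegralRep 2), r.domain = box → r'.domain = box →
    EqOn r.integrand (fun x => (q : ℝ) / (1 - x 0 * x 1 + (x 0 * x 1) ^ 2)) box →
    EqOn r'.integrand (fun x => (3 * (q : ℝ) / 2) / (1 + x 0 * x 1 + (x 0 * x 1) ^ 2)) box →
    KZ.Equivalent r r'

/-- Companion kill of the same card (log-derivative part of level 3 dies into level 1):
`⟨q (1+2xy)/Φ₃(xy)⟩ ∼ ⟨(2q/3)/(1−xy)⟩` (one `DilationMove` with `m = 3` on the rep with integrand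
`(q/3)/(1−xy)`, identity `dil3_e1`). -/
def LogDerivativeKillThree : Prop :=
  DilationMove → ∀ (q : ℚ) (r r' : KZ.IntegralRep 2), r.domain = box → r'.domain = box →
    EqOn r.integrand (fun x => (q : ℝ) * (1 + 2 * (x 0 * x 1)) / (1 + x 0 * x 1 + (x 0 * x 1) ^ 2)) box →
    EqOn r'.integrand (fun x => (2 * (q : ℝ) / 3) / (1 - x 0 * x 1)) box →
    KZ.Equivalent r r'

/-! ## Card `numerator-module-transfer` -/

/-- TRANSFER `C⁺` (card numerator-module-transfer), pure algebra in `ℚ[X]`, no integral: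
every numerator `N` is, modulo the dilation syzygies `(1+X³)A − 4X·A(X²)` (level 3 → 6, m = 2),
`(1+X²+X⁴)B − 9X²·B(X³)` (level 2 → 6, m = 3) and the monomial syzygies `(1−X⁶)·M`,
`M ∈ span_ℚ {(k+1)²X^k − 1}`, a combination of the three normal-form numerators
`1 − X⁶` (constant `1`), `1 + X + ⋯ + X⁵` (`1/(1−t)`), `1 − X + X³ − X⁴` (`1/(1+t+t²)`). -/
def NumeratorModule : Prop :=
  ∀ N : ℚ[X], ∃ (a b c : ℚ) (A B M : ℚ[X]),
    M ∈ Submodule.span ℚ (Set.range fun k : ℕ => (((k:ℚ) + 1) ^ 2) • (X : ℚ[X]) ^ k - 1) ∧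
    N = C a * (1 - X ^ 6) + C b * (∑ i ∈ Finset.range 6, (X : ℚ[X]) ^ i)
          + C c * (1 - X + X ^ 3 - X ^ 4)
        + ((1 + X ^ 3) * A - 4 * X * A.comp (X ^ 2))
        + ((1 + X ^ 2 + X ^ 4) * B - 9 * X ^ 2 * B.comp (X ^ 3))
        + (1 - X ^ 6) * M

/-- INTERFACE, m = 2 family (card numerator-module-transfer): for every `A ∈ ℚ[X]` the level-3 rep
`A(t)/(1−t³)` and its dilation `4t·A(t²)/(1−t⁶)` (`t = xy`) are KZ-equivalent — ONE `DilationMove`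
instance, uniform in `A`, so the syzygy family is a ℚ-subspace of the kernel with no division. -/
def DilationGeneratorTwo : Prop :=
  DilationMove → ∀ (A : ℚ[X]) (r r' : KZ.IntegralRep 2), r.domain = box → r'.domain = box →
    EqOn r.integrand (fun x => (aeval (x 0 * x 1) A : ℝ) / (1 - (x 0 * x 1) ^ 3)) box →
    EqOn r'.integrand
      (fun x => 4 * (x 0 * x 1) * (aeval ((x 0 * x 1) ^ 2) A : ℝ) / (1 - (x 0 * x 1) ^ 6)) box →
    KZ.Equivalent r r'

/-- INTERFACE, m = 3 family: `B(t)/(1−t²) ∼ 9t²·B(t³)/(1−t⁶)` on the box, uniformly in `B`. -/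
def DilationGeneratorThree : Prop :=
  DilationMove → ∀ (B : ℚ[X]) (r r' : KZ.IntegralRep 2), r.domain = box → r'.domain = box →
    EqOn r.integrand (fun x => (aeval (x 0 * x 1) B : ℝ) / (1 - (x 0 * x 1) ^ 2)) box →
    EqOn r'.integrand
      (fun x => 9 * (x 0 * x 1) ^ 2 * (aeval ((x 0 * x 1) ^ 3) B : ℝ) / (1 - (x 0 * x 1) ^ 6)) box →
    KZ.Equivalent r r'

/-- Sanity: the crux decl is in scope under its route name (the cards conclude THIS decl). -/
example : Prop := ReductionTwoSix

end

end Summit.KontsevichZagierPeriods.KontsevichZagierPeriods.Cruxes.ReductionTwoSix.Ideator2
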